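import Summits.Ventures.PercRepro.RankLevelSetMinorPairSum
import Summits.Ventures.PercRepro.RankLevelSetBiIndepContainSkewUniform

/-! # RankLevelSetMinorPairUniform — THE MIXED PROFILE OF A UNIFORM MATROID IS A BINOMIAL WINDOW; THE RANK OF A
DIRECT SUM AND OF A UNIFORM MATROID ON A SUBSET (night-1 g29; dossier §41.12)

For the uniform matroid `U_{p,E} = modelMatroid hE ∅ q p` and a signature `(A, B)` (`A, B ⊆ E`,
`m = #(E ∖ (A ∪ B))`): `p_i(A,B) = C(m, i)` if `i + #A ≤ p` and `m − i + #B ≤ p`, else `0`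
(**`minorPairCount_uniform`**) — every `i`-subset qualifies or none does. The ranks needed to evaluate the
hypotheses of (M₀)/(Diag) on explicit matroids: **`mpRk_uniform`** (`r(X) = min(#X, p)` on `X ⊆ E`) and
**`mpRk_disjointSum`** (`r(X) = r_M(X ∩ E_M) + r_N(X ∩ E_N)`, by `disjointSum_isBasis_iff`). Together with
`minorPairCount_disjointSum` (the convolution) these compute the mixed profile and the ranks of every direct sum of
uniform matroids with any signature — the data of the refutation of (M₀) and (Diag) (dossier §41.12 (b)). Every
declaration has a docstring; imports: the cell's own modules and Mathlib only. Axioms: standard. -/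

namespace PercRepro

open Set Matroid

variable {α : Type}

/-! ## The mixed profile of a uniform matroid -/

/-- **The mixed profile of the uniform matroid `U_{p,E}` is a binomial window**: for `A, B ⊆ E`,
`p_i(A,B) = C(m, i)` when `i + #A ≤ p` and `m − i + #B ≤ p` (`m = #(E ∖ (A ∪ B))`), and `0` otherwise (no
disjointness of `A`, `B` is needed). -/
theorem minorPairCount_uniform {E : Set α} (hE : E.Finite) (q p : ℕ) {A B : Set α} (hA : A ⊆ E) (hB : B ⊆ E)
    (i : ℕ) :
    minorPairCount (modelMatroid hE ∅ q p) A B i =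
      if i + A.ncard ≤ p ∧ (E \ (A ∪ B)).ncard - i + B.ncard ≤ p then (E \ (A ∪ B)).ncard.choose i else 0 := by
  have hKfin : (E \ (A ∪ B)).Finite := hE.subset Set.sdiff_subset
  have hAfin : A.Finite := hE.subset hA
  have hBfin : B.Finite := hE.subset hB
  unfold minorPairCount minorPairSets
  simp only [modelMatroid_E, uniform_indep_iff]
  -- for `S ⊆ E ∖ (A ∪ B)` with `#S = i` the two conditions are independent of `S`
  have key : ∀ S : Set α, S ⊆ E \ (A ∪ B) → S.ncard = i →
      ((S ∪ A ⊆ E ∧ (S ∪ A).ncard ≤ p) ∧ ((E \ (A ∪ B)) \ S ∪ B ⊆ E ∧ ((E \ (A ∪ B)) \ S ∪ B).ncard ≤ p) ↔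
        (i + A.ncard ≤ p ∧ (E \ (A ∪ B)).ncard - i + B.ncard ≤ p)) := by
    intro S hSE hScard
    have hSfin : S.Finite := hKfin.subset hSE
    have hdisjA : Disjoint S A := by
      rw [Set.disjoint_left]; intro x hxS hxA; exact (hSE hxS).2 (Or.inl hxA)
    have hdisjB : Disjoint ((E \ (A ∪ B)) \ S) B := by
      rw [Set.disjoint_left]; intro x hx hxB; exact hx.1.2 (Or.inr hxB)
    have h1 : (S ∪ A).ncard = i + A.ncard := by
      rw [Set.ncard_union_eq hdisjA hSfin hAfin, hScard]
    have h2 : ((E \ (A ∪ B)) \ S ∪ B).ncard = (E \ (A ∪ B)).ncard - i + B.ncard := by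
      rw [Set.ncard_union_eq hdisjB (hKfin.subset Set.sdiff_subset) hBfin, Set.ncard_sdiff' hSE hKfin, hScard]
    have h3 : S ∪ A ⊆ E := Set.union_subset (hSE.trans Set.sdiff_subset) hA
    have h4 : (E \ (A ∪ B)) \ S ∪ B ⊆ E := Set.union_subset (Set.sdiff_subset.trans Set.sdiff_subset) hB
    rw [h1, h2]
    tauto
  split_ifs with hcond
  · rw [← ncard_subsets_of_finite hKfin i]
    congr 1
    ext S
    simp only [Set.mem_setOf_eq]
    constructor
    · rintro ⟨hSE, hScard, -⟩; exact ⟨hSE, hScard⟩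
    · rintro ⟨hSE, hScard⟩
      refine ⟨hSE, hScard, ?_⟩
      have := (key S hSE hScard).mpr hcond
      exact ⟨this.1, this.2⟩
  · rw [Set.ncard_eq_zero (hKfin.finite_subsets.subset (fun S hS => hS.1))]
    ext S
    simp only [Set.mem_setOf_eq, Set.mem_empty_iff_false, iff_false, not_and]
    intro hSE hScard hind hd1 hd2
    exact hcond ((key S hSE hScard).mp ⟨hind, hd1, hd2⟩)

/-! ## Ranks: the uniform matroid on a subset, and a direct sum -/

/-- **The rank of a subset in a uniform matroid**: `r(X) = min(#X, p)` for `X ⊆ E` (`U_{p,E} = modelMatroid hE ∅ p p`). -/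
theorem mpRk_uniform {E : Set α} (hE : E.Finite) (p : ℕ) {X : Set α} (hX : X ⊆ E) :
    haveI := modelMatroid_finite hE ∅ p p
    mpRk (modelMatroid hE ∅ p p) X = min X.ncard p := by
  haveI := modelMatroid_finite hE ∅ p p
  have h := modelMatroid_eRk hE ∅ (le_refl p) hX
  simp only [Set.inter_empty, Set.ncard_empty, Set.sdiff_empty, Nat.zero_min, zero_add] at h
  rw [← coe_mpRk] at h
  exact_mod_cast h

variable {M N : Matroid α} [M.Finite] [N.Finite] {h : Disjoint M.E N.E}

/-- **The rank of a subset of a direct sum is the sum of the ranks of its traces**: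
`r_{M ⊕ N}(X) = r_M(X ∩ E_M) + r_N(X ∩ E_N)` for `X ⊆ E_M ∪ E_N`. -/
theorem mpRk_disjointSum {X : Set α} (hX : X ⊆ M.E ∪ N.E) :
    haveI : (M.disjointSum N h).Finite :=
      ⟨by rw [Matroid.disjointSum_ground_eq]; exact M.ground_finite.union N.ground_finite⟩
    mpRk (M.disjointSum N h) X = mpRk M (X ∩ M.E) + mpRk N (X ∩ N.E) := by
  haveI hfin : (M.disjointSum N h).Finite :=
    ⟨by rw [Matroid.disjointSum_ground_eq]; exact M.ground_finite.union N.ground_finite⟩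
  have hXE : X ⊆ (M.disjointSum N h).E := by rw [Matroid.disjointSum_ground_eq]; exact hX
  obtain ⟨I, hI⟩ := (M.disjointSum N h).exists_isBasis X hXE
  have hI' := Matroid.disjointSum_isBasis_iff.mp hI
  obtain ⟨hIM, hIN, hIX, -⟩ := hI'
  have hIfin : I.Finite := (M.ground_finite.union N.ground_finite).subset (hIX.trans hX)
  have h1 : mpRk (M.disjointSum N h) X = I.ncard := by
    have := hI.encard_eq_eRk
    rw [← coe_mpRk, ← hIfin.cast_ncard_eq] at this
    exact_mod_cast this.symm
  have h2 : mpRk M (X ∩ M.E) = (I ∩ M.E).ncard := by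
    have := hIM.encard_eq_eRk
    rw [← coe_mpRk, ← (hIfin.inter_of_left _).cast_ncard_eq] at this
    exact_mod_cast this.symm
  have h3 : mpRk N (X ∩ N.E) = (I ∩ N.E).ncard := by
    have := hIN.encard_eq_eRk
    rw [← coe_mpRk, ← (hIfin.inter_of_left _).cast_ncard_eq] at this
    exact_mod_cast this.symm
  rw [h1, h2, h3]
  exact ncard_eq_ncard_inter_add_ncard_inter h (hIX.trans hX) hIfin

end PercRepro
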